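import Literature.IUT.HodgeArakelov.ModelReconstructionInvariance

/-!
# Bridge B8, part 9: transporting the Def. 1.1 output of the [EtTh] model along an automorphism of the
# mono-theta environment reproduces it — [IUTchII] Def. 1.1 «functorial algorithm» for `ModelReconstruction`
# (proof-only companion of `Def11OutputTransport` p409662, `ModelReconstruction` p410630, part 7 p416541)

abc-iut cell, layer L6, seat abc-iut-L6-d6 (gen 3). [IUTchII] Def. 1.1 (kurims pp. 20–21) asks for FUNCTORIAL
group-theoretic algorithms `M ↦ (Π_Y(M), …, (l·Δ_Θ)(M) ⊗ ℤ/Nℤ ≅ Π_μ(M))`; SUBDAG-IUTchII-Cor-110 row r4 records the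
two kernel halves: transport along isomorphisms (B8 part 4, `Def11Output.transport`) and the construction for the
model (part 5b, `ModelFrame.def11OutputOfModel`). This file checks that they MATCH: for an identification
`e : Π_M ≃ Π^tp_Y[μ_N]` and an automorphism `φ` of the [IUTchII]-typed mono-theta environment `M`,

* `transport φ (output at e) = output at φ⁻¹ ≫ e` on every component one can compare in `Π_M`
  (`coe_transport_cyclotomicRigidity_iso`, `transport_reconstruction_extCyc`, `transport_reconstruction_projY_apply`
  — definitional bookkeeping), hence, by part 7 (abc-iut-w5-d145's [EtTh] Cor. 2.19 (i) engine p415693 underneath):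
* if `φ` induces the identity on `Π_Y(M)` (relative to a mono-theta identification `ε` with the model `M(η)`), the
  transported rigidity isomorphism IS the original one, pointwise in `Π_M`
  (`coe_transport_cyclotomicRigidity_eq_of_over_id`; input BY NAME `Cor219_i_splittings`, F-0626, or `Prop214_i`,
  F-0631, via `…'`) — THE isomorphism is an invariant of `M`, fixed by all of `Aut(M)` over `Π_Y(M)`;
* if `φ` lies over `γ ∈ Aut(Π^tp_X)`, the transported isomorphism is the original one precomposed with `γ`'s action
  on `(l·Δ_Θ)(M)` (`coe_transport_cyclotomicRigidity_mk_of_over`) — the naturality square of [IUTchII] Cor. 1.10.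

HONEST FRAMING: proof-only (no definitions, no new named facts); [EtTh] inputs BY NAME; nothing disputed is
asserted; no side is taken on [IUTchIII] Cor. 3.12; typed ≠ discharged. [claim: Mochizuki2012, status: disputed]
(IUTchII §1 Def 1.1, kurims pp.20-21); [cite: MochizukiEtTh2009, Cor 2.19(i) p.64].
-/

noncomputable section

namespace Literature.IUT.HodgeArakelov

universe u

open Literature.AnabelianGeometry.EtaleTheta MonoThetaBridge ModelCyclotomes
open scoped Literature.AnabelianGeometry.EtaleTheta

namespace ModelFrame

variable {S : ThetaSetting.{u}} {l : ℕ} {R : RigidData.{u} S.N l} (F : ModelFrame S R)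
  {M : MonoThetaEnv S} (e : M.Pi ≃ₜ* R.env) (φ : MonoThetaEnv.Iso M M)

/-! ## Transport along `φ` = output at `φ⁻¹ ≫ e` (bookkeeping) -/

/-- `Π_M ↠ Π_Y(M)` of the transported output is that of the output at `φ⁻¹ ≫ e`.
[claim: Mochizuki2012, status: disputed] (IUTchII §1 Def 1.1 (i), kurims p.21) -/
theorem transport_reconstruction_projY_apply (m : M.Pi) :
    ((F.reconstruction e).transport φ).projY m = (F.reconstruction (φ.iso.symm.trans e)).projY m := rfl

/-- `Π_μ(M)` of the transported output is that of the output at `φ⁻¹ ≫ e`.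
[claim: Mochizuki2012, status: disputed] (IUTchII §1 Def 1.1 (i), kurims p.21) -/
theorem transport_reconstruction_extCyc :
    ((F.reconstruction e).transport φ).extCyc = (F.reconstruction (φ.iso.symm.trans e)).extCyc := by
  ext m
  rfl

/-- `(l·Δ_Θ)(M)` is kept by transport and does not depend on the identification.
[claim: Mochizuki2012, status: disputed] (IUTchII §1 Def 1.1 (i), kurims p.21) -/
theorem transport_reconstruction_intCyc :
    ((F.reconstruction e).transport φ).intCyc = (F.reconstruction (φ.iso.symm.trans e)).intCyc := rfl

/-- **Transport matches the model construction**: the rigidity isomorphism of `(output at e).transport φ` and the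
one of the output at `φ⁻¹ ≫ e` coincide pointwise in `Π_M` (both are `c ↦ φ(e⁻¹(ι(intModEquiv c)))`).
[claim: Mochizuki2012, status: disputed] (IUTchII §1 Def 1.1 (ii), kurims p.21) -/
theorem coe_transport_cyclotomicRigidity_iso (c : ModPow (intCyc R).carrier (S.N : ℕ)) :
    ((((F.cyclotomicRigidity e).transport φ).iso c : ((F.reconstruction e).transport φ).extCyc) : M.Pi) =
      ((F.cyclotomicRigidity (φ.iso.symm.trans e)).iso c : M.Pi) := rfl

/-- The same for the bundled output `def11OutputOfModel`. [claim: Mochizuki2012, status: disputed] (IUTchII §1 Def 1.1, kurims pp.20-21) -/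
theorem coe_transport_def11OutputOfModel_iso (c : ModPow (intCyc R).carrier (S.N : ℕ)) :
    ((((F.def11OutputOfModel e).transport φ).rigidity.iso c : ((F.def11OutputOfModel e).transport φ).recon.extCyc) :
        M.Pi) = ((F.def11OutputOfModel (φ.iso.symm.trans e)).rigidity.iso c : M.Pi) := rfl

/-! ## Invariance / naturality of THE rigidity isomorphism under `Aut(M)` -/

section OverModel

variable {η : R.PiYdd → R.mu} {hη : η ∈ R.thetaCocycles} (ε : M.toEtale.Iso (R.modelMono hη))

/-- The mono-theta identification `φ⁻¹ ≫ ε` of `M` with the model, as an [EtTh] isomorphism.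
[cite: MochizukiEtTh2009, Def 2.13(ii) p.48] -/
theorem etaleIsoTrans_symm_toEtale_e :
    (etaleIsoTrans (etaleIsoSymm φ.toEtale) ε).e = φ.iso.symm.trans ε.e := rfl

/-- **THE Def. 1.1 (ii) isomorphism is fixed by every automorphism of `M` over `Π_Y(M)`**: if `φ ∈ Aut(M)` induces
the identity on the quotient `Π_M ↠ Π^tp_Y` (read through a mono-theta identification `ε : M ⥲ M(η)`), then
transporting the output at `ε` along `φ` returns THE SAME rigidity isomorphism, pointwise in `Π_M`. Input BY NAME:
[EtTh] Cor. 2.19 (i) (`Cor219_i_splittings`, F-0626). [claim: Mochizuki2012, status: disputed] (IUTchII §1 Def 1.1 (ii), kurims p.21) -/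
theorem coe_transport_cyclotomicRigidity_eq_of_over_id (h219 : R.Cor219_i_splittings)
    (hφ : ∀ m : M.Pi, CycEnvelope.proj R.augY R.chi (ε.e (φ.iso m)) = CycEnvelope.proj R.augY R.chi (ε.e m))
    (c : ModPow (intCyc R).carrier (S.N : ℕ)) :
    ((((F.cyclotomicRigidity ε.e).transport φ).iso c : ((F.reconstruction ε.e).transport φ).extCyc) : M.Pi) =
      ((F.cyclotomicRigidity ε.e).iso c : M.Pi) := by
  rw [coe_transport_cyclotomicRigidity_iso, ← etaleIsoTrans_symm_toEtale_e φ ε]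
  refine F.coe_cyclotomicRigidity_eq_of_iso_over_id h219 ε _ (fun m => ?_) c
  show CycEnvelope.proj R.augY R.chi (ε.e (φ.iso.symm m)) = _
  conv_rhs => rw [← φ.iso.apply_symm_apply m]
  exact (hφ (φ.iso.symm m)).symm

/-- The same from [EtTh] Prop. 2.14 (i) (`Prop214_i`, F-0631) via part 7's `…'` form.
[claim: Mochizuki2012, status: disputed] (IUTchII §1 Def 1.1 (ii), kurims p.21) -/
theorem coe_transport_cyclotomicRigidity_eq_of_over_id' (h214 : R.Prop214_i)
    (hφ : ∀ m : M.Pi, CycEnvelope.proj R.augY R.chi (ε.e (φ.iso m)) = CycEnvelope.proj R.augY R.chi (ε.e m))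
    (c : ModPow (intCyc R).carrier (S.N : ℕ)) :
    ((((F.cyclotomicRigidity ε.e).transport φ).iso c : ((F.reconstruction ε.e).transport φ).extCyc) : M.Pi) =
      ((F.cyclotomicRigidity ε.e).iso c : M.Pi) := by
  have hover : ∀ x : R.env, CycEnvelope.proj R.augY R.chi ((etaleIsoTrans (etaleIsoSymm φ.toEtale) ε).e
      (ε.e.symm x)) = CycEnvelope.proj R.augY R.chi (ε.e (ε.e.symm x)) := fun x => by
    show CycEnvelope.proj R.augY R.chi (ε.e (φ.iso.symm (ε.e.symm x))) = _
    conv_rhs => rw [← φ.iso.apply_symm_apply (ε.e.symm x)]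
    exact (hφ (φ.iso.symm (ε.e.symm x))).symm
  -- the automorphism `ε⁻¹ ≫ φ⁻¹ ≫ ε` of the model lies over the identity of `Π^tp_Y`
  have hβ : ∀ x : R.env, CycEnvelope.proj R.augY R.chi
      ((etaleIsoTrans (etaleIsoSymm ε) (etaleIsoTrans (etaleIsoSymm φ.toEtale) ε)).e x) =
      CycEnvelope.proj R.augY R.chi x := fun x => by
    have h := hover x
    rw [ContinuousMulEquiv.apply_symm_apply] at h
    exact h
  rw [coe_transport_cyclotomicRigidity_iso, ← etaleIsoTrans_symm_toEtale_e φ ε,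
    iso_e_eq_trans ε (etaleIsoTrans (etaleIsoSymm φ.toEtale) ε)]
  exact F.coe_cyclotomicRigidity_trans_eq_of_over_id' ε.e h214 hη _ hβ c

/-- **Naturality under `Aut(M)` over `γ`**: if `φ ∈ Aut(M)` lies over `γ ∈ Aut(Π^tp_X)` (read through `ε`) and
`γ(l·Δ_Θ) ⊆ l·Δ_Θ`, then the transported rigidity isomorphism at `[γ g]` is THE rigidity isomorphism at `[g]`,
`g ∈ l·Δ_Θ` — [IUTchII] Cor. 1.10's naturality square for the output of `M`. Input BY NAME: `Cor219_i_splittings`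
(F-0626). [claim: Mochizuki2012, status: disputed] (IUTchII §1 Cor 1.10, kurims p.47) -/
theorem coe_transport_cyclotomicRigidity_mk_of_over (h219 : R.Cor219_i_splittings) (γ : R.PiX ≃ₜ* R.PiX)
    (hφ : ∀ m : M.Pi, ((CycEnvelope.proj R.augY R.chi (ε.e (φ.iso.symm m)) : R.PiY) : R.PiX) =
      γ ((CycEnvelope.proj R.augY R.chi (ε.e m) : R.PiY) : R.PiX))
    (g : R.lDeltaTheta) (hγg : γ g ∈ R.lDeltaTheta) :
    ((((F.cyclotomicRigidity ε.e).transport φ).iso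
        (((intCycEquiv R).symm ((⟨γ g, hγg⟩ : R.lDeltaTheta) : lDeltaQuot R) : (intCyc R).carrier) :
          ModPow (intCyc R).carrier (S.N : ℕ)) : ((F.reconstruction ε.e).transport φ).extCyc) : M.Pi) =
      ((F.cyclotomicRigidity ε.e).iso
        (((intCycEquiv R).symm (g : lDeltaQuot R) : (intCyc R).carrier) :
          ModPow (intCyc R).carrier (S.N : ℕ)) : M.Pi) := by
  rw [coe_transport_cyclotomicRigidity_iso, ← etaleIsoTrans_symm_toEtale_e φ ε]
  exact F.coe_cyclotomicRigidity_eq_of_iso_over h219 ε _ γ hφ g hγg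

end OverModel

end ModelFrame

end Literature.IUT.HodgeArakelov

end
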